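import Summits.BirchSwinnertonDyer.BirchSwinnertonDyer.Theorems.ClassRecordThreeEulerHalvesAtThreeJetchevTight
import Summits.BirchSwinnertonDyer.Rank1Residual.X11b.BDPRouteSurj

/-!
# Route `ClassRecordThree` (rung K2@3), crux 5 `EulerHalvesAtThree` (item 19109, shared by
# `KolyvaginRoadThree`): the open inputs J₃ʳ ∕ J₃⁰ are NECESSARY — on the Heegner data the proof uses
# they FOLLOW from the Euler-system half itself plus print (cell `bsd-stepL`, seat `bsd-stepL-tam3-p1`,
# session g2; `--supports stmt-BirchSwinnertonDyer-19109 --as helper`)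

The reduction of this seat (files 1–2, p419384 ∕ p419735) proves the Euler-system half
`Typed.MissingUpperBoundAt W 3` on X11b@3 ∧ (ram) and on ¬(ram) ∧ surj FROM the Jetchev direction J₃
(global `3^s`-divisibility of the derived Heegner points to depth `t = ord₃ ∏ c_ℓ(E)`), using J₃ at ONE
kind of frame only: a Heegner field `K` with ODD `d_K` and `L(E^{d_K},1) ≠ 0` (the Hoffstein–Luo field of
`exists_oddHeegnerData`) and a Manin-good conductor-`1` frame `(Dt, β, ι)`. This file proves the
CONVERSE on exactly those frames, from PUBLISHED inputs only:

* §1 `shaIndexBound_sharp_three_of_missingUpperBoundAt` — at such a datum `(K, Dt, H, ι, P)`: the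
  Euler-system half over `ℚ` for `E` (`Typed.MissingUpperBoundAt W 3`) + Wuthrich 2014 Prop. 21 for the
  twist `E^{d_K}` (rank `0`, multiplicative at `3`, `ρ̄` onto — the tree's `twist_le_half_of_wuthrich`,
  the KATO direction, no (ram) needed) + the exact Gross–Zagier bookkeeping identity of the route
  (`exists_shaAn_padicVal_eq_of_heegner`: `ord₃ q + ord₃ q_d + t + 2·ord₃ #E^{d_K}(ℚ)_tors = 2·ord₃[E(K):ℤP]`,
  `ord₃ #Ш(E/K) = ord₃ #Ш(E) + ord₃ #Ш(E^{d_K})`) ⟹ the Tamagawa-SHARP Kolyvagin bound over `K`,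
  `ord₃ #Ш(E/K) + 2t ≤ 2·ord₃[E(K):ℤP]`.
* §2 `globalDivisibility_three_of_missingUpperBoundAt` — hence (file 5 = `…JetchevTight.lean` §5, McCallum's
  Cor. 5.6 in certificate form) J₃ AT EVERY SUCH FRAME: every derived point `P_n`, `n ∈ S_r(s)`, `s ≤ t`,
  is `3^s`-divisible in `E(K[n])`.
* §3 class level: `jetchevDivisibilityRamHL_of_upperHalfRam` — the Euler-system half on ALL of X11b@3 ∧
  (ram) (the three routes' joint output there: Schneider road (a) on non-split `3`, 19110's Shimura
  displays on the pure-β shape, 19109's clauses (α), (γ∖α)) IMPLIES J₃ʳ restricted to Hoffstein–Luo-type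
  fields («J₃ʳ♭»: `r_an(E) = 1`, `d_K` odd, `L(E^{d_K},1) ≠ 0`); `jetchevDivisibilityNotRamHL_of_eulerSurjClause`
  — clause (0) of the crux VERBATIM (`ClassX11b W 3 → Surj W 3 → ¬Ram W 3 → MissingUpperBoundAt W 3`)
  IMPLIES J₃⁰♭.

WHAT THIS BUYS (honest). Together with files 1–2 and 5: on Hoffstein–Luo-type frames, J₃ and the
Euler-system half over `ℚ` are EQUIVALENT modulo print (McCallum Cor. 5.6 both readings, Wuthrich Prop. 21,
Skinner Thm. C ∕ TL₃ for the forward direction off (ram), Gross–Zagier, Kolyvagin, GZK, modularity,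
Shimura reciprocity, Darmon 3.6). So the registered stubs cannot be refuted on those frames without
refuting `BSD₃`; and the part of the registered J₃ʳ ∕ J₃⁰ that the composition actually USES is the
♭-restriction — a NOTE for the planner: the stubs' `K`-binder may be narrowed to `Odd d_K ∧ L(E^{d_K},1) ≠ 0
∧ r_an(E) = 1` at no cost to the composition (the broad binder also ranges over `K` with
`r_an(E/K) ≥ 3`, where `y_K` is torsion and McCallum's `M₀` is not defined). Nothing here proves J₃ or
any half of BSD; every theorem is CONDITIONAL on the binders it lists; no item closes.

References: [Wuthrich2014] Prop. 21 (p. 400); [JetchevSkinnerWan2017] §7.4.1–7.4.2 (eq:gz for K′),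
(eq:tamK); [McCallumLMS1991] §5 Cor. 5.6; [GrossZagier1986] V.§2; [GrossLMS1991] §4 (4.1);
[Darmon2004] Thm. 3.6; [HoffsteinLuo1997] Theorem §1; [Mazur1978] Cor. 4.1; files p419384, p419735,
`ClassRecordThreeEulerHalvesAtThreeJetchevTight.lean` (this seat), `X11b/BDPRouteShaAn.lean`,
`X11b/BDPRouteSurj.lean`, `X11b/Three/TamagawaAdditiveThree.lean`.
-/

noncomputable section

open scoped Classical

namespace Summit.BirchSwinnertonDyer.Rank1Residual.X11b.Three.Koly

open WeierstrassCurve Literature.NumberTheory.EllipticCurves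
  Literature.NumberTheory.EllipticCurves.ModularForms
  Literature.NumberTheory.EllipticCurves.Rank1Residual
  Literature.NumberTheory.EllipticCurves.Wuthrich2014
  Literature.NumberTheory.EllipticCurves.KrizLi2019
  Summit.BirchSwinnertonDyer.Rank1Residual Summit.BirchSwinnertonDyer.Rank1Residual.X11b

/-! ### §1 At one odd Heegner datum: the upper half over `ℚ` + Wuthrich for the twist ⟹ the sharp bound over `K` -/

/-- **The Tamagawa-sharp Kolyvagin bound over `K` FROM the Euler-system half over `ℚ` (one datum).**
Data: `W/ℚ` globally minimal with `r_an = 1`, multiplicative at `3`, `ρ̄_{E,3}` onto; `K` imaginary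
quadratic with `d_K` ODD, Heegner for `N_E`, `L(E^{d_K},1) ≠ 0`; a Heegner datum `(Dt, H, ι)` with
`3 ∤ c(Dt)` and `P ∈ E(K)` over its complex Heegner point; `Wd = Cd • W^{(d_K)}` globally minimal.
PUBLISHED binders: Gross–Zagier `hGZ`, Kolyvagin `hKo`, Wuthrich 2014 Prop. 21 `hWu` (the rank-`0`
`≥`-half — Kato's direction — for `E^{d_K}`: multiplicative at `3`, `ρ̄` onto, no (ram) needed), GZK
`hGZK`, modularity `hmod`. IF `Typed.MissingUpperBoundAt W 3` (`hU`: `ord₃ #Ш(E) ≤ ord₃ #Ш(E)_an`) THEN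
`Ш(E/K)` is finite, `P` has infinite order and `ord₃ #Ш(E/K) + 2·ord₃ ∏c_ℓ(E) ≤ 2·ord₃[E(K):ℤP]`.
Proof: `3` splits in `K` (`3 ∣ N`), so `3 ∤ d_K`, `d_K < −4`, `#𝓞_K^× = 2`; the route's exact identity
`exists_shaAn_padicVal_eq_of_heegner` (`ord₃ q + ord₃ q_d + t + 2·ord₃ #E^{d_K}(ℚ)_tors = 2·ord₃ I`,
`ord₃ #Ш(E/K) = ord₃ #Ш(E) + ord₃ #Ш(E^{d_K})`) with `q = #Ш(E)_an`, `q_d = L(E^{d_K},1)/Ω` from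
Wuthrich (`ord₃ #Ш(E^{d_K}) + ord₃ ∏c(E^{d_K}) − 2·ord₃ #tors ≤ ord₃ q_d`), `hU` (`ord₃ #Ш(E) ≤ ord₃ q`)
and the transport `ord₃ ∏c(E^{d_K}) = ord₃ ∏c(E)` add up. CONDITIONAL on the binders.
[cite: Wuthrich2014, Prop. 21 (p. 400)] [cite: JetchevSkinnerWan2017, §7.4.1 (eq:gz for K′) and §7.3.1 (eq:tamK), pp. 29–31]
[cite: Miller2011LMS, Def. 1.1] -/
theorem shaIndexBound_sharp_three_of_missingUpperBoundAt
    (W : WeierstrassCurve ℚ) [W.IsElliptic] [W.IsGloballyMinimal] [NeZero (W.conductorNorm ℤ)]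
    (K : Type) [Field K] [NumberField K]
    (Dt : ModularParametrizationData W (W.conductorNorm ℤ))
    (H : HeegnerDatum (W.conductorNorm ℤ) (NumberField.discr K)) (ι : K →+* ℂ)
    (P : (W.baseChange K).toAffine.Point)
    -- published inputs
    (hGZ : gross_zagier (W.conductorNorm ℤ) W K) (hKo : kolyvagin (W.conductorNorm ℤ) W K)
    (hWu : sha_dvd_analyticSha)
    (hGZK : rank_eq_analyticRank_of_analyticRank_le_one) (hmod : hasEntireLFunction_rat)
    -- the pair
    (hr : W.analyticRank = 1) (hmult : W.HasMultiplicativeReductionAtPrime 3) (hρ : Surj W 3)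
    -- the Heegner data
    (hK : IsImaginaryQuadratic K) (hodd : Odd (NumberField.discr K))
    (hHN : SatisfiesHeegnerHypothesis (W.conductorNorm ℤ) K)
    (hP : WeierstrassCurve.Affine.Point.map ι.toRatAlgHom P = heegnerPointComplex Dt H)
    (hc : ¬ (3 : ℤ) ∣ Dt.c)
    (hLt : (W.quadraticTwist (NumberField.discr K : ℚ)).entireLFunction 1 ≠ 0)
    (Wd : WeierstrassCurve ℚ) [Wd.IsElliptic] [Wd.IsGloballyMinimal] (Cd : VariableChange ℚ)
    (hWd : Cd • W.quadraticTwist (NumberField.discr K : ℚ) = Wd)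
    -- the Euler-system half over ℚ for E
    (hU : Typed.MissingUpperBoundAt W 3) :
    Finite (W.baseChange K).sha ∧ ¬ IsOfFinAddOrder P ∧
      padicValNat 3 (Nat.card (W.baseChange K).sha) + 2 * padicValNat 3 W.tamagawaProduct ≤
        2 * padicValNat 3 (AddSubgroup.zmultiples P).index := by
  haveI : Fact (Nat.Prime 3) := ⟨Nat.prime_three⟩
  have hp2 : (3 : ℕ) ≠ 2 := by norm_num
  have hD0 : (NumberField.discr K : ℚ) ≠ 0 := by exact_mod_cast NumberField.discr_ne_zero K
  haveI hEt : (W.quadraticTwist (NumberField.discr K : ℚ)).IsElliptic := W.isElliptic_quadraticTwist hD0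
  -- `3` splits in `K`, so `3 ∤ d_K`; `d_K` odd and `< −4`, so `#𝓞_K^× = 2`
  have h3split : SatisfiesHeegnerHypothesis 3 K :=
    SatisfiesHeegnerHypothesis.of_dvd (dvd_conductorNorm_of_mult (W := W) hmult) hHN
  have hpd : ¬ ((3 : ℕ) : ℤ) ∣ NumberField.discr K := not_dvd_discr_of_split hK Nat.prime_three hp2 h3split
  have hlt : NumberField.discr K < -4 := by
    have hneg : NumberField.discr K < 0 := hK.discr_neg
    have habs : 2 < |NumberField.discr K| := NumberField.abs_discr_gt_two (by rw [hK.1]; norm_num)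
    rw [abs_of_neg hneg] at habs
    have h3 : NumberField.discr K ≠ -3 := fun h ↦ hpd (h ▸ ⟨-1, by norm_num⟩)
    obtain ⟨m, hm⟩ := hodd
    omega
  have hμ : ¬ 3 ∣ NumberField.Units.torsionOrder K := by
    haveI : NumberField.IsTotallyComplex K := hK.2
    rw [Literature.NumberTheory.DiophantineGeometry.torsionOrder_eq_two_of_discr_lt hK.1 hlt]
    norm_num
  -- the twist: multiplicative at 3, ρ̄ onto, L(E^D,1) ≠ 0; Wuthrich's `≤` (Kato direction)
  have hmultd : Wd.HasMultiplicativeReductionAtPrime 3 :=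
    hasMultiplicativeReductionAtPrime_twist_of_heegner' W 3 K hK hHN hmult Cd hWd
  have hsurjd : Surj Wd 3 := surj_twist_model W 3 K hρ Cd hWd
  have hLt' : (W.quadraticTwist (NumberField.discr K : ℚ)).entireLFunction = Wd.entireLFunction := by
    rw [← hWd, entireLFunction_smul]
  have hLd1 : Wd.entireLFunction 1 ≠ 0 := by rw [← hLt']; exact hLt
  obtain ⟨qd, hqd, hwu⟩ := twist_le_half_of_wuthrich hWu hGZK hmod Wd 3 hp2 hLd1 hmultd hsurjd
  -- transports: Tamagawa exponent and the unit of the minimal twist model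
  have htam : padicValNat 3 Wd.tamagawaProduct = padicValNat 3 W.tamagawaProduct :=
    X2.padicValNat_tamagawaProduct_twist_of_heegner_of_odd W 3 hp2 K hK hodd hpd hHN Cd hWd
  have hu : padicValRat 3 (Cd.u : ℚ) = 0 := padicValRat_u_eq_zero_of_twist_minimal W 3 K hK hHN hmult Cd hWd
  -- the exact Gross–Zagier bookkeeping identity at the datum
  obtain ⟨-, hfinK, hsha, q, hq, hval⟩ := exists_shaAn_padicVal_eq_of_heegner W 3 (W.conductorNorm ℤ) K Dt
    H ι P hGZ hKo hGZK hmod hK hHN hP hp2 hc hμ hr hLt Wd Cd hWd hu qd hqd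
  -- the upper half over ℚ for E: `ord₃ #Ш(E) ≤ ord₃ q`
  obtain ⟨q', hq', hle⟩ := hU
  have hqq : q' = q := by exact_mod_cast hq'.symm.trans hq
  subst hqq
  -- the Heegner point has infinite order
  have hL0 : W.entireLFunction 1 = 0 := entireLFunction_one_eq_zero_of_analyticRank_eq_one hr
  obtain ⟨-, hderiv⟩ := leadingLCoeff_eq_deriv_of_analyticRank_eq_one hr
  have hLK : LDerivEK W K ≠ 0 := by
    rw [lDerivEK_eq_deriv_mul W K hmod hL0]; exact mul_ne_zero hderiv hLt
  have hPinf : ¬ IsOfFinAddOrder P :=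
    (lDerivEK_ne_zero_iff_not_isOfFinAddOrder W (W.conductorNorm ℤ) K hGZ hK hHN ⟨Dt, H, ι, hP⟩).mp hLK
  refine ⟨hfinK, hPinf, ?_⟩
  -- add up
  have e1 : (padicValNat 3 (W.baseChange K).shaOrder : ℤ) =
      padicValNat 3 W.shaOrder + padicValNat 3 Wd.shaOrder := by exact_mod_cast hsha
  have e2 : (padicValNat 3 Wd.tamagawaProduct : ℤ) = padicValNat 3 W.tamagawaProduct := by
    exact_mod_cast htam
  have e3 : (padicValNat 3 (W.baseChange K).shaOrder : ℤ) + 2 * padicValNat 3 W.tamagawaProduct ≤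
      2 * padicValNat 3 (AddSubgroup.zmultiples P).index := by omega
  exact_mod_cast e3

/-! ### §2 … hence J₃ at every Hoffstein–Luo-type frame -/

/-- **J₃ at a frame FROM the Euler-system half over `ℚ`** (necessity of the stub at the frames the
composition uses). For `W/ℚ` globally minimal with `r_an = 1`, multiplicative at `3`, `ρ̄_{E,3}` onto,
and `Typed.MissingUpperBoundAt W 3`; `K` imaginary quadratic Heegner for `N_E` with `d_K` ODD and
`L(E^{d_K},1) ≠ 0`; a Manin-good frame `(Dt, β, ι)` (`4N_E ∣ β² − d_K`, `3 ∤ c(Dt)`): every derived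
Heegner point `P_n` on the frame with `n` a square-free product of Kolyvagin primes of index `≥ s`,
`s ≤ t = ord₃ ∏ c_ℓ(E)`, is `3^s`-divisible in `E(K[n])`. PUBLISHED binders: `hGZ`, `hKo`, Wuthrich
`hWu`, `hGZK`, `hmod`, Shimura reciprocity at conductor `1` `hrec`, Darmon 2004 Thm. 3.6 `hD36`,
McCallum Cor. 5.6 certificate form `hMcL`. Proof: a Heegner datum `H` with `H.β = β`
(`nonempty_heegnerDatum_holds`), the `K`-rational point `P` over its complex point
(`heegnerPointComplex_mem_range_map_holds`), a minimal model of the twist; §1 gives the sharp bound at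
`P`; the conductor-`1` datum `d₁` on the frame has `P_1 = P` in `E(K̄)` (Shimura reciprocity); rank one,
no `3`-torsion (Kolyvagin, irreducibility); then `globalDivisibility_three_of_shaIndexBound_sharp`.
CONDITIONAL on the binders. [cite: McCallumLMS1991, §5 Cor. 5.6 (p. 310)] [cite: Wuthrich2014, Prop. 21 (p. 400)]
[cite: GrossLMS1991, §4 (4.1)] [cite: Darmon2004, Thm. 3.6 (PDF p. 43)] -/
theorem globalDivisibility_three_of_missingUpperBoundAt
    -- published inputs
    (hGZ : ∀ (N : ℕ) [NeZero N] (W : WeierstrassCurve ℚ) (K : Type) [Field K] [NumberField K],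
      gross_zagier N W K)
    (hKo : ∀ (N : ℕ) [NeZero N] (W : WeierstrassCurve ℚ) (K : Type) [Field K] [NumberField K],
      kolyvagin N W K)
    (hWu : sha_dvd_analyticSha)
    (hGZK : rank_eq_analyticRank_of_analyticRank_le_one) (hmod : hasEntireLFunction_rat)
    (hrec : ∀ (N : ℕ) [NeZero N] (W : WeierstrassCurve ℚ) (K : Type) [Field K] [NumberField K],
      heegnerPointOfConductor_one_galoisConj N W K)
    (hD36 : ∀ (N : ℕ) [NeZero N] (W : WeierstrassCurve ℚ) (K : Type) [Field K] [NumberField K],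
      phi_heegnerTau_mem_singularModuliField N W K)
    (hMcL : McCallum1991_pow_dvd_card_sha_primary_of_certificate)
    -- the pair, the field, the frame
    (W : WeierstrassCurve ℚ) [W.IsElliptic] [W.IsGloballyMinimal] [NeZero (W.conductorNorm ℤ)]
    (K : Type) [Field K] [NumberField K]
    (Dt : ModularParametrizationData W (W.conductorNorm ℤ)) (β : ℤ) (ι : K →+* ℂ)
    (hr : W.analyticRank = 1) (hmult : W.HasMultiplicativeReductionAtPrime 3) (hρ : Surj W 3)
    (hK : IsImaginaryQuadratic K) (hodd : Odd (NumberField.discr K))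
    (hHN : SatisfiesHeegnerHypothesis (W.conductorNorm ℤ) K)
    (hLt : (W.quadraticTwist (NumberField.discr K : ℚ)).entireLFunction 1 ≠ 0)
    (hβ : (4 * (W.conductorNorm ℤ : ℤ)) ∣ β ^ 2 - NumberField.discr K) (hc : ¬ (3 : ℤ) ∣ Dt.c)
    -- the Euler-system half over ℚ for E
    (hU : Typed.MissingUpperBoundAt W 3) :
    ∀ (s : ℕ), s ≤ padicValNat 3 W.tamagawaProduct →
      ∀ (n : ℕ) (d : KolyvaginHeegnerData Dt β ι n), Squarefree n →
        (∀ ℓ ∈ n.primeFactors, Zhang2014.IsKolyvaginPrime (W.conductorNorm ℤ) W K 3 ℓ ∧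
          s ≤ Zhang2014.kolyvaginIndex W 3 ℓ) → PDiv d 3 s := by
  haveI : Fact (Nat.Prime 3) := ⟨Nat.prime_three⟩
  -- a Heegner datum with this β, the K-rational Heegner point, a minimal model of the twist
  obtain ⟨H, hHβ⟩ := nonempty_heegnerDatum_holds (W.conductorNorm ℤ) K hK hβ
  subst hHβ
  obtain ⟨P, hP⟩ := heegnerPointComplex_mem_range_map_holds (W.conductorNorm ℤ) W K hK hHN Dt H ι
  have hD0 : (NumberField.discr K : ℚ) ≠ 0 := by exact_mod_cast NumberField.discr_ne_zero K
  haveI hEt : (W.quadraticTwist (NumberField.discr K : ℚ)).IsElliptic := W.isElliptic_quadraticTwist hD0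
  obtain ⟨Cd, hCd⟩ := hasGlobalMinimalModel_rat_holds (W.quadraticTwist (NumberField.discr K : ℚ))
  haveI : (Cd • W.quadraticTwist (NumberField.discr K : ℚ)).IsGloballyMinimal := hCd
  -- §1: the sharp bound over K at P
  obtain ⟨hfinK, hPinf, hbound⟩ := shaIndexBound_sharp_three_of_missingUpperBoundAt W K Dt H ι P
    (hGZ _ W K) (hKo _ W K) hWu hGZK hmod hr hmult hρ hK hodd hHN hP hc hLt
    (Cd • W.quadraticTwist (NumberField.discr K : ℚ)) Cd rfl hU
  haveI : Finite (W.baseChange K).sha := hfinK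
  -- d_K ∉ {−3, −4}
  have h3split : SatisfiesHeegnerHypothesis 3 K :=
    SatisfiesHeegnerHypothesis.of_dvd (dvd_conductorNorm_of_mult (W := W) hmult) hHN
  have hpd : ¬ ((3 : ℕ) : ℤ) ∣ NumberField.discr K :=
    not_dvd_discr_of_split hK Nat.prime_three (by norm_num) h3split
  have h3 : NumberField.discr K ≠ -3 := fun h ↦ hpd (h ▸ ⟨-1, by norm_num⟩)
  have h4 : NumberField.discr K ≠ -4 := by
    intro h
    rw [h] at hodd
    exact (Int.not_odd_iff_even.mpr ⟨-2, by norm_num⟩) hodd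
  -- the conductor-1 datum on the frame and P_1 = P (Shimura reciprocity)
  obtain ⟨d₁⟩ := exists_kolyvaginHeegnerData_one (hD36 _ W K) hK Dt H.β ι H.dvd_sq_sub
  have hPd : d₁.toGeomPoints d₁.derivedPoint = toGeomPoints (W.baseChange K) P :=
    KolyvaginBottom.toGeomPoints_derivedPoint_one_eq (hrec _ W K) hK hHN hP d₁ rfl
  -- rank one (Kolyvagin) and no 3-torsion (E[3] irreducible)
  obtain ⟨hrank, -⟩ := hKo (W.conductorNorm ℤ) W K hK hHN ⟨Dt, H, ι, hP⟩ hPinf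
  have hirr : Irr W 3 := hasIrreducibleModPGaloisRep_of_hasSurjectiveModNGaloisRep W 3 hρ
  have hbot := torsionBy_eq_bot_of_isImaginaryQuadratic_of_hasIrreducibleModPGaloisRep W K hK
    Nat.prime_three hirr
  have hiv : ∀ x : (W.baseChange K).toAffine.Point, 3 • x = 0 → x = 0 := fun x hx ↦ by
    have hmem : x ∈ AddSubgroup.torsionBy (W.baseChange K).toAffine.Point ((3 : ℕ) : ℤ) := by
      rw [mem_torsionBy_iff, natCast_zsmul]
      exact hx
    rw [hbot] at hmem
    exact hmem
  -- file 5, §5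
  exact globalDivisibility_three_of_shaIndexBound_sharp hMcL W K hmult hρ hK h3 h4 hHN Dt H.β ι d₁ P hPd
    hPinf hrank hiv hbound

/-! ### §3 Class level: the Euler-system half on (ram) ∕ clause (0) ⟹ J₃ʳ♭ ∕ J₃⁰♭ -/

/-- **J₃ʳ♭ is NECESSARY for the Euler-system half on X11b@3 ∧ (ram).** If `Typed.MissingUpperBoundAt W 3`
holds for every `(E,3) ∈` X11b with a (ram) witness (`hUram` — the joint output on (ram) of crux 19109's
clauses (α), (γ∖α), item 19110's pure-β clause and the Schneider road on non-split `3`), then J₃ holds at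
every Manin-good conductor-`1` frame over every imaginary quadratic Heegner `K` with ODD `d_K` and
`L(E^{d_K},1) ≠ 0` of every such curve (`r_an = 1`, multiplicative at `3`, `ρ̄_{E,3}` onto, (ram)) — the
♭-restriction of the registered stub `stub_jetchevDivisibilityRamAtThree`, which is the part of it
`missingUpperBoundAt_three_of_classX11b_of_ram_of_jetchevDivisibility` (file 1) uses. PUBLISHED binders as
in §2. CONDITIONAL; nothing asserted about either side. [cite: McCallumLMS1991, §5 Cor. 5.6 (p. 310)]
[cite: Wuthrich2014, Prop. 21 (p. 400)] [cite: JetchevSkinnerWan2017, §7.4.2 (p. 31)] -/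
theorem jetchevDivisibilityRamHL_of_upperHalfRam
    (hGZ : ∀ (N : ℕ) [NeZero N] (W : WeierstrassCurve ℚ) (K : Type) [Field K] [NumberField K],
      gross_zagier N W K)
    (hKo : ∀ (N : ℕ) [NeZero N] (W : WeierstrassCurve ℚ) (K : Type) [Field K] [NumberField K],
      kolyvagin N W K)
    (hWu : sha_dvd_analyticSha)
    (hGZK : rank_eq_analyticRank_of_analyticRank_le_one) (hmod : hasEntireLFunction_rat)
    (hrec : ∀ (N : ℕ) [NeZero N] (W : WeierstrassCurve ℚ) (K : Type) [Field K] [NumberField K],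
      heegnerPointOfConductor_one_galoisConj N W K)
    (hD36 : ∀ (N : ℕ) [NeZero N] (W : WeierstrassCurve ℚ) (K : Type) [Field K] [NumberField K],
      phi_heegnerTau_mem_singularModuliField N W K)
    (hMcL : McCallum1991_pow_dvd_card_sha_primary_of_certificate)
    -- the Euler-system half on all of X11b@3 ∧ (ram)
    (hUram : ∀ (W : WeierstrassCurve ℚ) [W.IsElliptic] [W.IsGloballyMinimal],
      ClassX11b W 3 → Ram W 3 → Typed.MissingUpperBoundAt W 3) :
    ∀ (W : WeierstrassCurve ℚ) [W.IsElliptic] [W.IsGloballyMinimal] [NeZero (W.conductorNorm ℤ)]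
      (K : Type) [Field K] [NumberField K]
      (Dt : ModularParametrizationData W (W.conductorNorm ℤ)) (β : ℤ) (ι : K →+* ℂ),
      W.analyticRank = 1 → W.HasMultiplicativeReductionAtPrime 3 → Surj W 3 → Ram W 3 →
      IsImaginaryQuadratic K → SatisfiesHeegnerHypothesis (W.conductorNorm ℤ) K →
      Odd (NumberField.discr K) → (W.quadraticTwist (NumberField.discr K : ℚ)).entireLFunction 1 ≠ 0 →
      (4 * (W.conductorNorm ℤ : ℤ)) ∣ β ^ 2 - NumberField.discr K → ¬ (3 : ℤ) ∣ Dt.c →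
      ∀ (s : ℕ), s ≤ padicValNat 3 W.tamagawaProduct →
        ∀ (n : ℕ) (d : KolyvaginHeegnerData Dt β ι n), Squarefree n →
          (∀ ℓ ∈ n.primeFactors, Zhang2014.IsKolyvaginPrime (W.conductorNorm ℤ) W K 3 ℓ ∧
            s ≤ Zhang2014.kolyvaginIndex W 3 ℓ) → PDiv d 3 s := by
  intro W _ _ _ K _ _ Dt β ι hr hmult hρ hram hK hHN hodd hLt hβ hc
  haveI : Fact (Nat.Prime 3) := ⟨Nat.prime_three⟩
  have hirr : Irr W 3 := hasIrreducibleModPGaloisRep_of_hasSurjectiveModNGaloisRep W 3 hρ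
  have hX : ClassX11b W 3 := ⟨hr, by norm_num, hmult, hirr⟩
  exact globalDivisibility_three_of_missingUpperBoundAt hGZ hKo hWu hGZK hmod hrec hD36 hMcL W K Dt β ι hr
    hmult hρ hK hodd hHN hLt hβ hc (hUram W hX hram)

/-- **J₃⁰♭ is NECESSARY for clause (0) of the crux.** Clause (0) of `EulerHalvesAtThree` VERBATIM
(`∀ W, ClassX11b W 3 → Surj W 3 → ¬Ram W 3 → Typed.MissingUpperBoundAt W 3`) implies J₃ at every
Manin-good conductor-`1` frame over every imaginary quadratic Heegner `K` with ODD `d_K` and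
`L(E^{d_K},1) ≠ 0` of every ¬(ram) curve of X11b@3 with `ρ̄_{E,3}` onto — the ♭-restriction of the
registered stub `stub_jetchevDivisibilityNotRamAtThree` (the part file 2's
`missingUpperBoundAt_three_of_classX11b_of_surj_of_not_ram_of_jetchevDivisibility_of_twistLower` uses;
the forward direction there needs TL₃ in addition). PUBLISHED binders as in §2. CONDITIONAL.
[cite: McCallumLMS1991, §5 Cor. 5.6 (p. 310)] [cite: Wuthrich2014, Prop. 21 (p. 400)] -/
theorem jetchevDivisibilityNotRamHL_of_eulerSurjClause
    (hGZ : ∀ (N : ℕ) [NeZero N] (W : WeierstrassCurve ℚ) (K : Type) [Field K] [NumberField K],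
      gross_zagier N W K)
    (hKo : ∀ (N : ℕ) [NeZero N] (W : WeierstrassCurve ℚ) (K : Type) [Field K] [NumberField K],
      kolyvagin N W K)
    (hWu : sha_dvd_analyticSha)
    (hGZK : rank_eq_analyticRank_of_analyticRank_le_one) (hmod : hasEntireLFunction_rat)
    (hrec : ∀ (N : ℕ) [NeZero N] (W : WeierstrassCurve ℚ) (K : Type) [Field K] [NumberField K],
      heegnerPointOfConductor_one_galoisConj N W K)
    (hD36 : ∀ (N : ℕ) [NeZero N] (W : WeierstrassCurve ℚ) (K : Type) [Field K] [NumberField K],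
      phi_heegnerTau_mem_singularModuliField N W K)
    (hMcL : McCallum1991_pow_dvd_card_sha_primary_of_certificate)
    -- clause (0) of the crux, verbatim
    (hU0 : ∀ (W : WeierstrassCurve ℚ) [W.IsElliptic] [W.IsGloballyMinimal],
      ClassX11b W 3 → Surj W 3 → ¬ Ram W 3 → Typed.MissingUpperBoundAt W 3) :
    ∀ (W : WeierstrassCurve ℚ) [W.IsElliptic] [W.IsGloballyMinimal] [NeZero (W.conductorNorm ℤ)]
      (K : Type) [Field K] [NumberField K]
      (Dt : ModularParametrizationData W (W.conductorNorm ℤ)) (β : ℤ) (ι : K →+* ℂ),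
      W.analyticRank = 1 → W.HasMultiplicativeReductionAtPrime 3 → Surj W 3 → ¬ Ram W 3 →
      IsImaginaryQuadratic K → SatisfiesHeegnerHypothesis (W.conductorNorm ℤ) K →
      Odd (NumberField.discr K) → (W.quadraticTwist (NumberField.discr K : ℚ)).entireLFunction 1 ≠ 0 →
      (4 * (W.conductorNorm ℤ : ℤ)) ∣ β ^ 2 - NumberField.discr K → ¬ (3 : ℤ) ∣ Dt.c →
      ∀ (s : ℕ), s ≤ padicValNat 3 W.tamagawaProduct →
        ∀ (n : ℕ) (d : KolyvaginHeegnerData Dt β ι n), Squarefree n →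
          (∀ ℓ ∈ n.primeFactors, Zhang2014.IsKolyvaginPrime (W.conductorNorm ℤ) W K 3 ℓ ∧
            s ≤ Zhang2014.kolyvaginIndex W 3 ℓ) → PDiv d 3 s := by
  intro W _ _ _ K _ _ Dt β ι hr hmult hρ hram hK hHN hodd hLt hβ hc
  haveI : Fact (Nat.Prime 3) := ⟨Nat.prime_three⟩
  have hirr : Irr W 3 := hasIrreducibleModPGaloisRep_of_hasSurjectiveModNGaloisRep W 3 hρ
  have hX : ClassX11b W 3 := ⟨hr, by norm_num, hmult, hirr⟩
  exact globalDivisibility_three_of_missingUpperBoundAt hGZ hKo hWu hGZK hmod hrec hD36 hMcL W K Dt β ι hr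
    hmult hρ hK hodd hHN hLt hβ hc (hU0 W hX hρ hram)

end Summit.BirchSwinnertonDyer.Rank1Residual.X11b.Three.Koly

end
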